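import Mathlib

/-!
# DAG node N11 — «we remove the δ-functions using the operator C» ([III] p. 267) AS A THEOREM, part 1 of 2:
# the LINEAR FIBRE CHART of the δ-removal (the remaining variables `B`, the operator `C` with `B′ = CB`, the corridor right inverse `h`
# with `LQ̃h = I`), its constant Jacobian `|det Q_{b₀}|⁻¹`, and `∫ dB′ F(B′) = |det Q_{b₀}|⁻¹ ∫ dy ∫ dB F(CB + hy)`

HEADER — WORK-UNIT METADATA.  Cell `pub-ymgap`, YM-PLAN Track A (HUMAN RULING D-0062), WIDTH SEAT `pub-ymgap-dag-n11-w6` (R399 (3a) re-mint, g0b), node N11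
[B14], route `BalabanUVNodes`, item K1⁷ `StabilityBAtRecordR13SepCoPH` = stmt-QuantumFields-20542 (helper lane, `--kind proof --supports 20542 --as helper`,
count-neutral).  [I] = [Balaban1987RG1] (CMP 109), [III] = [Balaban1988Convergent] (CMP 119), [13] = [Balaban1985BackgroundPropagators] (CMP 99), [16] =
[Balaban1985UV3] (CMP 102).  Part 2 (`…DeltaRemovalLinearFibreChartByName`) feeds dag-n11-d's socket `BalabanUVNodesN11KernelTransportInFibreChart` BY NAME
and specialises to print's `h = B10Eq17LocalSolution.hOpLin b₀ h`.

WHY THIS FILE.  The located reading of [III] §3's supply (dag-n11-e LOCATED-SALPHA-v3; dag-lead ME #37 «N11-III-267-DELTA-REMOVAL»; lit-balaban desk answer of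
record, 2026-08-28): the printed form of the (B4) assembly «conditional law of product Haar along the averaging, in the chart» is THREE identity-class steps —
S1 Haar → chart density ([16] p. 260), S2 the linearising change of variables with its Jacobian ([16] (17)–(22); [I] p. 267 «B′ = B − hD(B)»), S3 the removal of
the δ-functions by the operator C ([I] p. 267 last line – p. 268 L.1–5; [13] Sect. E p. 428; [16] p. 271).  THIS FILE PROVES S3 AS A THEOREM, as the LINEAR
instance of a fibre chart: for a LINEAR block averaging `Q : (ι → X) →ₗ[ℝ] (κ → X)` (fine bonds `ι`, blocks `κ`, Lie algebra `X` = any finite-dimensional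
real normed space with an additive Haar `volume`), a splitting of the bonds `e : σ ⊕ κ ≃ ι` into «the remaining variables» `σ` and the corridor bonds
`b₀(c) = e (inr c)`, a corridor-supported right inverse `H` of `Q` (print's `h`: «LQ̃h = I», «hB is equal to 0 everywhere, except the set {b₀(c)}», [I]
p. 267 L.16–25) and an operator `C` («B′ = CB, C … is an identity operator on almost all bonds, except the bonds b₀ for which a value (CB̃)(b₀) is equal to a
solution of the equation (QB)(c) = 0», [13] p. 428), the map `Φ (y, B) = C B + H y` satisfies
  `hfib`  — `Q (C B + H y) = y` EXACTLY (§1), and every fine field is a chart point, `B′ = C (B′↾σ) + H (Q B′)`;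
  `hpush` — `(dy ⊗ dB)` pushed forward by `Φ` is `|det Q_{b₀}| · dB′` (§2), `|det Q_{b₀}|⁻¹ = |det (H read on the corridor bonds)|` (= `∏_c |det h(c)|` for
            print's `h`, part 2 — the constant «−Σ_c log det S(V^{(k)}, b₀(c))» of [16] p. 271);
hence (§3) `∫ dB′ F(B′) = |det (H↾corridor)| · ∫ dy ∫ dB F(CB + Hy)` for every integrable `F`, both Fubini orders — the lit-balaban desk stub's hypothesis-form
`DeltaRemovalPrinted` as a theorem (its `CorridorData ∕ opC ∕ corridorBlock` NOT restated: hypothesis-form, 0 `def`).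

WHAT THIS FILE PROVES (0 `def`, 0 `sorry`, standard axioms).  The data `e, Q, H, C` are free letters bound by the displayed identities `hQH : ∀ y, Q (H y) = y`,
`hH : ∀ y s, H y (e (inl s)) = 0`, `hC : ∀ B s, C B (e (inl s)) = B s`, `hQC : ∀ B, Q (C B) = 0`; §§2–3 use only `hQH, hH, hC` (`hQC` enters the inverse
chart of §1 and `hfib`).
§1 `linearAvg_chart` (hfib, exact) · `chart_apply_rest` · `chart_injective` · `corridorRead_injective ∕ _surjective` · `eq_zero_of_rest_eq_zero_of_linearAvg_eq_zero` ·
   ★ `eq_chart` · `chart_surjective` · ★ `opC_unique` («C is the operator determined by the configuration») · `corridorInverse_unique` («h is uniquely defined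
   by these conditions») · ★ `exists_opC` (extension by zero minus `H∘Q∘`(extension by zero) qualifies).
§2 `measurable_chart` · `det_corridorRead_ne_zero` · ★★ `map_chart_prod_eq_smul_volume` · ★★ `measurePreserving_chart` · ★ `hpush_linear` ∕ `hfib_linear` (the two
   DISPLAYED hypotheses of dag-n11-d's socket, literally, with the constant fibre reference `Kernel.const _ volume`).
§3 ★ `lintegral_eq_lintegral_chart` · `integrable_comp_chart` · ★★ `integral_eq_integral_chart` · `integral_eq_integral_chart_symm`.

HONEST FRAMING.  Helper lane of K1⁷; count-neutral; finite-dimensional linear algebra + Lebesgue measure ∕ Tonelli–Fubini only (Mathlib `MeasurePreserving.skew_product`,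
`map_linearMap_addHaar_eq_smul_addHaar`, `volume_measurePreserving_sumPiEquivProdPi ∕ piCongrLeft`) — NO Lie–Haar chart (S1), NO Jacobian of the linearisation
(47)∕(17) (S2), nothing at `fieldMeasure` (the concrete chart half stays the director's lever); nothing of Bałaban is asserted beyond bookkeeping shape; (B4)∕(S-α)
NOT closed; N11 NOT discharged; K1⁷ NOT closed; node counts unmoved.  One finite `𝕋⁴_{L^K}` programme at fixed `ε = L^{−K}`; R4 closes only the conditional
finite-𝕋⁴ rung `BalabanLadder.UV` — NOT ℝ⁴, NOT OS, NOT a mass gap, NOT Clay.  No `sorry`, `axiom`, `def`, `instance`, `notation`.  Matrix ∕ Gaussian twins in the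
tree (cited, not used): `Beta.ConstraintElimination.elim` (`B′ = CB̃` as a matrix; KKT determinant), `B9SectECov` §7 (Gaussian fibre Fubini of (3.173)),
`B12HOperator267.IsQppLocal.hOp_rightInverse_iff` («LQ̃h = I»).  Sources (SHAPE ∕ bookkeeping only): [I] (1.4) p.260, p.267 L.16–32, p.268 L.1–5, (2.12) p.268;
[III] p.267 L.18–24; [13] Sect. E p.428, (3.157)–(3.158); [16] (16)–(18) pp.259–260, p.271.
-/

noncomputable section

open MeasureTheory ProbabilityTheory
open scoped ENNReal NNReal

namespace Summit.QuantumFields.YangMills.Theorems.BalabanUVNodesN11DeltaRemovalLinearFibreChart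

/-! ## §1  Algebra of the δ-removal: the chart `Φ (y, B) = C B + H y`, its exact fibre identity, bijectivity, and the uniqueness of `C` and `h` -/

section Algebra

variable {X : Type*} [AddCommGroup X] [Module ℝ X]
variable {ι κ σ : Type*} {e : σ ⊕ κ ≃ ι}
variable {Q : (ι → X) →ₗ[ℝ] (κ → X)} {H : (κ → X) →ₗ[ℝ] (ι → X)} {C : (σ → X) →ₗ[ℝ] (ι → X)}

/-- **`hfib`, EXACTLY**: the chart point `C B + H y` averages to `y` — «LQ̃h = I» and «(CB̃)(b₀) … a solution of the equation (QB)(c) = 0».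
[cite: Balaban1987RG1, p.267 L.16–25; Balaban1985BackgroundPropagators, Sect. E p.428] -/
theorem linearAvg_chart (hQH : ∀ y, Q (H y) = y) (hQC : ∀ B, Q (C B) = 0) (y : κ → X) (B : σ → X) :
    Q (C B + H y) = y := by
  rw [map_add, hQC, hQH, zero_add]

/-- On «the remaining variables» the chart point `C B + H y` reads `B` («hB is equal to 0 everywhere, except the set {b₀(c)}»; «C … is an identity
operator on almost all bonds»). [cite: Balaban1987RG1, p.267 L.16–20, p.268 L.1–3; Balaban1985BackgroundPropagators, Sect. E p.428] -/
theorem chart_apply_rest (hH : ∀ y s, H y (e (Sum.inl s)) = 0) (hC : ∀ B s, C B (e (Sum.inl s)) = B s)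
    (y : κ → X) (B : σ → X) (s : σ) : (C B + H y) (e (Sum.inl s)) = B s := by
  rw [Pi.add_apply, hC, hH, add_zero]

/-- The chart `(y, B) ↦ C B + H y` is one-to-one (read `y` through `Q`, `B` on the remaining bonds). [cite: Balaban1987RG1, p.268 L.1–5] -/
theorem chart_injective (hQH : ∀ y, Q (H y) = y) (hH : ∀ y s, H y (e (Sum.inl s)) = 0)
    (hC : ∀ B s, C B (e (Sum.inl s)) = B s) (hQC : ∀ B, Q (C B) = 0) :
    Function.Injective (fun p : (κ → X) × (σ → X) => C p.2 + H p.1) := by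
  intro p q hpq
  dsimp only at hpq
  refine Prod.ext ?_ ?_
  · have h1 := congrArg Q hpq
    rwa [linearAvg_chart hQH hQC, linearAvg_chart hQH hQC] at h1
  · funext s
    have h2 := congrFun hpq (e (Sum.inl s))
    rwa [chart_apply_rest hH hC, chart_apply_rest hH hC] at h2

/-- `H` read on the corridor bonds, `y ↦ (c ↦ (H y)(b₀ c))`, is one-to-one (it is `⊕_c h(c)` for `H = hOpLin b₀ h`, §5). [cite: Balaban1987RG1, p.267 L.16–25] -/
theorem corridorRead_injective (hQH : ∀ y, Q (H y) = y) (hH : ∀ y s, H y (e (Sum.inl s)) = 0) :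
    Function.Injective (fun y : κ → X => fun c => H y (e (Sum.inr c))) := by
  intro y₁ y₂ h12
  dsimp only at h12
  have hH12 : H y₁ = H y₂ := by
    funext i
    obtain ⟨j, rfl⟩ := e.surjective i
    cases j with
    | inl s => rw [hH, hH]
    | inr c => exact congrFun h12 c
  rw [← hQH y₁, ← hQH y₂, hH12]

variable [FiniteDimensional ℝ X] [Finite κ]

/-- … hence onto (an injective endomorphism of the finite-dimensional space of corridor variables). [cite: Balaban1987RG1, p.267 L.16–25] -/
theorem corridorRead_surjective (hQH : ∀ y, Q (H y) = y) (hH : ∀ y s, H y (e (Sum.inl s)) = 0) :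
    Function.Surjective (fun y : κ → X => fun c => H y (e (Sum.inr c))) := by
  have hT : Function.Injective ((LinearMap.funLeft ℝ X (fun c => e (Sum.inr c))) ∘ₗ H) :=
    corridorRead_injective hQH hH
  exact LinearMap.injective_iff_surjective.mp hT

/-- **THE KEY SEPARATION**: a fine field vanishing on the remaining bonds and averaging to `0` is `0` (the corridor variables are determined by the
constraint — «using the δ-functions δ(Q̃B′) we eliminate the variables B′(b₀(c))»). [cite: Balaban1987RG1, p.268 L.1–2] -/
theorem eq_zero_of_rest_eq_zero_of_linearAvg_eq_zero (hQH : ∀ y, Q (H y) = y) (hH : ∀ y s, H y (e (Sum.inl s)) = 0)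
    {D : ι → X} (hD : ∀ s, D (e (Sum.inl s)) = 0) (hQD : Q D = 0) : D = 0 := by
  obtain ⟨y, hy⟩ := corridorRead_surjective hQH hH (fun c => D (e (Sum.inr c)))
  dsimp only at hy
  have hHy : H y = D := by
    funext i
    obtain ⟨j, rfl⟩ := e.surjective i
    cases j with
    | inl s => rw [hH, hD]
    | inr c => exact congrFun hy c
  have hy0 : y = 0 := by rw [← hQH y, hHy, hQD]
  rw [← hHy, hy0, map_zero]

/-- **★ EVERY FINE FIELD IS A CHART POINT**: `B′ = C (B′↾σ) + H (Q B′)` — the inverse chart reads the remaining variables and the block averages.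
[cite: Balaban1987RG1, p.268 L.1–5; Balaban1985BackgroundPropagators, Sect. E p.428] -/
theorem eq_chart (hQH : ∀ y, Q (H y) = y) (hH : ∀ y s, H y (e (Sum.inl s)) = 0)
    (hC : ∀ B s, C B (e (Sum.inl s)) = B s) (hQC : ∀ B, Q (C B) = 0) (B' : ι → X) :
    B' = C (fun s => B' (e (Sum.inl s))) + H (Q B') := by
  rw [← sub_eq_zero]
  refine eq_zero_of_rest_eq_zero_of_linearAvg_eq_zero hQH hH (fun s => ?_) ?_
  · rw [Pi.sub_apply, chart_apply_rest hH hC, sub_self]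
  · rw [map_sub, linearAvg_chart hQH hQC, sub_self]

/-- The chart `(y, B) ↦ C B + H y` is onto. [cite: Balaban1987RG1, p.268 L.1–5] -/
theorem chart_surjective (hQH : ∀ y, Q (H y) = y) (hH : ∀ y s, H y (e (Sum.inl s)) = 0)
    (hC : ∀ B s, C B (e (Sum.inl s)) = B s) (hQC : ∀ B, Q (C B) = 0) :
    Function.Surjective (fun p : (κ → X) × (σ → X) => C p.2 + H p.1) :=
  fun B' => ⟨(Q B', fun s => B' (e (Sum.inl s))), (eq_chart hQH hH hC hQC B').symm⟩

/-- **★ «C is the operator determined by the configuration»**: two operators that are the identity on the remaining bonds and solve the constraint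
coincide. [cite: Balaban1987RG1, p.268 L.2–3; Balaban1985BackgroundPropagators, Sect. E p.428] -/
theorem opC_unique (hQH : ∀ y, Q (H y) = y) (hH : ∀ y s, H y (e (Sum.inl s)) = 0) {C₁ C₂ : (σ → X) →ₗ[ℝ] (ι → X)}
    (hC₁ : ∀ B s, C₁ B (e (Sum.inl s)) = B s) (hQC₁ : ∀ B, Q (C₁ B) = 0)
    (hC₂ : ∀ B s, C₂ B (e (Sum.inl s)) = B s) (hQC₂ : ∀ B, Q (C₂ B) = 0) : C₁ = C₂ := by
  refine LinearMap.ext fun B => ?_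
  rw [← sub_eq_zero]
  refine eq_zero_of_rest_eq_zero_of_linearAvg_eq_zero hQH hH (fun s => ?_) ?_
  · rw [Pi.sub_apply, hC₁, hC₂, sub_self]
  · rw [map_sub, hQC₁, hQC₂, sub_self]

/-- **«Of course h is uniquely defined by these conditions»**: two corridor-supported right inverses of `Q` coincide. [cite: Balaban1987RG1, p.267 L.20–22] -/
theorem corridorInverse_unique {H₁ H₂ : (κ → X) →ₗ[ℝ] (ι → X)}
    (hQH₁ : ∀ y, Q (H₁ y) = y) (hH₁ : ∀ y s, H₁ y (e (Sum.inl s)) = 0)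
    (hQH₂ : ∀ y, Q (H₂ y) = y) (hH₂ : ∀ y s, H₂ y (e (Sum.inl s)) = 0) : H₁ = H₂ := by
  refine LinearMap.ext fun y => ?_
  rw [← sub_eq_zero]
  refine eq_zero_of_rest_eq_zero_of_linearAvg_eq_zero hQH₁ hH₁ (fun s => ?_) ?_
  · rw [Pi.sub_apply, hH₁, hH₂, sub_self]
  · rw [map_sub, hQH₁, hQH₂, sub_self]

omit [FiniteDimensional ℝ X] [Finite κ] in
/-- **★ EXISTENCE OF THE OPERATOR C** — «B′ = CB»: extension by zero to the corridor bonds followed by the correction `−h(Q̃·)` is the identity on the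
remaining bonds and solves `(QB′)(c) = 0`; by `opC_unique` it is THE operator C. [cite: Balaban1987RG1, p.267 L.25–32, p.268 L.1–3; Balaban1985BackgroundPropagators, Sect. E p.428] -/
theorem exists_opC (hQH : ∀ y, Q (H y) = y) (hH : ∀ y s, H y (e (Sum.inl s)) = 0) :
    ∃ C : (σ → X) →ₗ[ℝ] (ι → X), (∀ B s, C B (e (Sum.inl s)) = B s) ∧ (∀ B, Q (C B) = 0) ∧
      ∀ B, C B = (fun i => Sum.elim B 0 (e.symm i)) - H (Q fun i => Sum.elim B 0 (e.symm i)) := by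
  let ext : (σ → X) →ₗ[ℝ] (ι → X) :=
    { toFun := fun B i => Sum.elim B 0 (e.symm i)
      map_add' := fun B₁ B₂ => by
        funext i
        simp only [Pi.add_apply]
        cases e.symm i with
        | inl s => simp only [Sum.elim_inl, Pi.add_apply]
        | inr c => simp only [Sum.elim_inr, Pi.zero_apply, add_zero]
      map_smul' := fun a B => by
        funext i
        simp only [Pi.smul_apply, RingHom.id_apply]
        cases e.symm i with
        | inl s => simp only [Sum.elim_inl, Pi.smul_apply]
        | inr c => simp only [Sum.elim_inr, Pi.zero_apply, smul_zero] }
  have hext : ∀ B i, ext B i = Sum.elim B 0 (e.symm i) := fun B i => rfl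
  refine ⟨ext - H ∘ₗ Q ∘ₗ ext, fun B s => ?_, fun B => ?_, fun B => ?_⟩
  · rw [LinearMap.sub_apply, Pi.sub_apply, LinearMap.comp_apply, LinearMap.comp_apply, hH, sub_zero, hext,
      Equiv.symm_apply_apply, Sum.elim_inl]
  · rw [LinearMap.sub_apply, map_sub, LinearMap.comp_apply, LinearMap.comp_apply, hQH, sub_self]
  · rfl

end Algebra

/-! ## §2  The measure identity: `(dy ⊗ dB).map Φ = |det Q_{b₀}| · dB′`, i.e. `hpush` with the constant Jacobian `|det Q_{b₀}|⁻¹ = |det (H↾corridor)|` -/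

section MeasureIdentity

variable {X : Type*} [NormedAddCommGroup X] [NormedSpace ℝ X] [FiniteDimensional ℝ X] [MeasureSpace X] [BorelSpace X]
  [(volume : Measure X).IsAddHaarMeasure]
variable {ι κ σ : Type*} [Fintype ι] [Fintype κ] [Fintype σ] {e : σ ⊕ κ ≃ ι}
variable {Q : (ι → X) →ₗ[ℝ] (κ → X)} {H : (κ → X) →ₗ[ℝ] (ι → X)} {C : (σ → X) →ₗ[ℝ] (ι → X)}

omit [(volume : Measure X).IsAddHaarMeasure] in
/-- The chart is (Borel) measurable. [cite: Balaban1987RG1, p.268 L.1–5 (bookkeeping)] -/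
theorem measurable_chart :
    Measurable (fun p : (κ → X) × (σ → X) => C p.2 + H p.1) :=
  ((C.continuous_of_finiteDimensional.comp continuous_snd).add
    (H.continuous_of_finiteDimensional.comp continuous_fst)).measurable

omit [MeasureSpace X] [BorelSpace X] [(volume : Measure X).IsAddHaarMeasure] [Fintype ι] [Fintype σ] in
/-- The corridor block is nonsingular: `det (H read on the corridor bonds) ≠ 0` (this determinant is `(det Q_{b₀})⁻¹`, §5). [cite: Balaban1987RG1, p.267 L.20–25] -/
theorem det_corridorRead_ne_zero (hQH : ∀ y, Q (H y) = y) (hH : ∀ y s, H y (e (Sum.inl s)) = 0) :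
    LinearMap.det ((LinearMap.funLeft ℝ X (fun c => e (Sum.inr c))) ∘ₗ H) ≠ 0 := by
  intro h0
  refine (LinearMap.det_eq_zero_iff_ker_ne_bot.mp h0) ?_
  exact LinearMap.ker_eq_bot.mpr (corridorRead_injective hQH hH)

/-- **★★ THE MEASURE IDENTITY OF THE δ-REMOVAL**: Lebesgue measure `dy ⊗ dB` on (block variables) × (remaining variables) is pushed by the chart
`(y, B) ↦ C B + H y` to `|det Q_{b₀}| · dB′`, `|det Q_{b₀}| = |det (H↾corridor)|⁻¹` — «the measure becomes a … measure in variables B» with the constant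
print moves into the normalisation ([16] p. 271 «the sum of terms −log det S(V^{(k)}, b₀(c))»).  Proof: split the bonds (`volume` on `ι → X` is the product
over `σ` and `κ`, Mathlib `volume_measurePreserving_sumPiEquivProdPi` ∕ `piCongrLeft`), then the skew product `(B, y) ↦ (B, (CB)↾corridor + (H↾corridor) y)`
whose fibre maps are affine with linear part `H↾corridor` (`map_linearMap_addHaar_eq_smul_addHaar`, translation invariance, `MeasurePreserving.skew_product`).
[cite: Balaban1987RG1, p.268 L.1–5; Balaban1985BackgroundPropagators, Sect. E p.428; Balaban1985UV3, p.271] -/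
theorem map_chart_prod_eq_smul_volume (hQH : ∀ y, Q (H y) = y) (hH : ∀ y s, H y (e (Sum.inl s)) = 0)
    (hC : ∀ B s, C B (e (Sum.inl s)) = B s) :
    Measure.map (fun p : (κ → X) × (σ → X) => C p.2 + H p.1) (volume.prod volume) =
      ENNReal.ofReal |(LinearMap.det ((LinearMap.funLeft ℝ X (fun c => e (Sum.inr c))) ∘ₗ H))⁻¹| • volume := by
  classical
  set T : (κ → X) →ₗ[ℝ] (κ → X) := (LinearMap.funLeft ℝ X (fun c => e (Sum.inr c))) ∘ₗ H with hT
  have hTapply : ∀ y c, T y c = H y (e (Sum.inr c)) := fun y c => rfl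
  have hTdet : LinearMap.det T ≠ 0 := det_corridorRead_ne_zero hQH hH
  -- (1) the coordinate merge `S (B, z) = Sum.elim B z ∘ e⁻¹`, measure preserving
  let S : (σ → X) × (κ → X) ≃ᵐ (ι → X) :=
    (MeasurableEquiv.sumPiEquivProdPi (fun _ : σ ⊕ κ => X)).symm.trans (MeasurableEquiv.piCongrLeft (fun _ : ι => X) e)
  have hSmp : MeasurePreserving S (volume.prod volume) volume :=
    (volume_measurePreserving_piCongrLeft (fun _ : ι => X) e).comp
      ((volume_measurePreserving_sumPiEquivProdPi (fun _ : σ ⊕ κ => X)).symm _)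
  have hSapply : ∀ (B : σ → X) (z : κ → X) (j : σ ⊕ κ), S (B, z) (e j) = Sum.elim B z j := by
    intro B z j
    change (MeasurableEquiv.piCongrLeft (fun _ : ι => X) e)
      ((MeasurableEquiv.sumPiEquivProdPi (fun _ : σ ⊕ κ => X)).symm (B, z)) (e j) = _
    rw [MeasurableEquiv.coe_piCongrLeft, Equiv.piCongrLeft_apply_apply]
    cases j <;> rfl
  -- (2) the skew map `(B, y) ↦ (B, (C B)↾corridor + T y)`
  let g : (σ → X) → (κ → X) → (κ → X) := fun B y => (fun c => C B (e (Sum.inr c))) + T y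
  have hgm : Measurable (Function.uncurry g) := by
    have hcont : Continuous fun p : (σ → X) × (κ → X) =>
        ((LinearMap.funLeft ℝ X (fun c => e (Sum.inr c))) ∘ₗ C) p.1 + T p.2 :=
      ((((LinearMap.funLeft ℝ X (fun c => e (Sum.inr c))) ∘ₗ C).continuous_of_finiteDimensional).comp continuous_fst).add
        (T.continuous_of_finiteDimensional.comp continuous_snd)
    exact hcont.measurable
  have hgmap : ∀ B, Measure.map (g B) volume = ENNReal.ofReal |(LinearMap.det T)⁻¹| • volume := by
    intro B
    have h1 : Measure.map T volume = ENNReal.ofReal |(LinearMap.det T)⁻¹| • (volume : Measure (κ → X)) :=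
      Measure.map_linearMap_addHaar_eq_smul_addHaar _ hTdet
    have h2 : g B = (fun w => (fun c => C B (e (Sum.inr c))) + w) ∘ T := rfl
    rw [h2, ← Measure.map_map (measurable_const_add _) T.continuous_of_finiteDimensional.measurable, h1,
      Measure.map_smul, map_add_left_eq_self]
  have hA : MeasurePreserving (fun p : (σ → X) × (κ → X) => (id p.1, g p.1 p.2)) (volume.prod volume)
      (volume.prod (ENNReal.ofReal |(LinearMap.det T)⁻¹| • volume)) :=
    (MeasurePreserving.id volume).skew_product hgm (Filter.Eventually.of_forall hgmap)
  -- (3) the chart in the order (B, y) is `S ∘ A`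
  have hΦ' : (fun p : (σ → X) × (κ → X) => C p.1 + H p.2) = S ∘ (fun p => (id p.1, g p.1 p.2)) := by
    funext p
    funext i
    obtain ⟨j, rfl⟩ := e.surjective i
    rw [Function.comp_apply, hSapply]
    cases j with
    | inl s => rw [Sum.elim_inl, id_eq]; exact chart_apply_rest hH hC _ _ _
    | inr c => rw [Sum.elim_inr]; rfl
  have hΦ'mp : MeasurePreserving (fun p : (σ → X) × (κ → X) => C p.1 + H p.2) (volume.prod volume)
      (ENNReal.ofReal |(LinearMap.det T)⁻¹| • volume) := by
    rw [hΦ']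
    refine MeasurePreserving.comp ⟨S.measurable, ?_⟩ hA
    rw [Measure.prod_smul_right, Measure.map_smul, hSmp.map_eq]
  -- (4) swap the factors
  have hΦ : (fun p : (κ → X) × (σ → X) => C p.2 + H p.1) =
      (fun p : (σ → X) × (κ → X) => C p.1 + H p.2) ∘ Prod.swap := rfl
  rw [hΦ]
  exact (hΦ'mp.comp (Measure.measurePreserving_swap (μ := (volume : Measure (κ → X))) (ν := (volume : Measure (σ → X))))).map_eq

/-- **★★ THE CHART IS MEASURE PRESERVING from `|det (H↾corridor)| · (dy ⊗ dB)` to `dB′`** — `hpush` with the constant Jacobian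
`J = |det (H↾corridor)| = |det Q_{b₀}|⁻¹`. [cite: Balaban1987RG1, p.268 L.1–5; Balaban1985UV3, p.271] -/
theorem measurePreserving_chart (hQH : ∀ y, Q (H y) = y) (hH : ∀ y s, H y (e (Sum.inl s)) = 0)
    (hC : ∀ B s, C B (e (Sum.inl s)) = B s) :
    MeasurePreserving (fun p : (κ → X) × (σ → X) => C p.2 + H p.1)
      (ENNReal.ofReal |LinearMap.det ((LinearMap.funLeft ℝ X (fun c => e (Sum.inr c))) ∘ₗ H)| • (volume.prod volume))
      volume := by
  refine ⟨measurable_chart, ?_⟩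
  rw [Measure.map_smul, map_chart_prod_eq_smul_volume hQH hH hC, smul_smul,
    ← ENNReal.ofReal_mul (abs_nonneg _), ← abs_mul, mul_inv_cancel₀ (det_corridorRead_ne_zero hQH hH),
    abs_one, ENNReal.ofReal_one, one_smul]

/-- **★ `hpush` OF THE SOCKET, LITERALLY** (dag-n11-d `BalabanUVNodesN11KernelTransportInFibreChart`, with `μ = dy`, the constant fibre reference
`κ_y = dB` — `Kernel.const` —, `J ≡ |det (H↾corridor)|`, `Ψ = Φ`, `ν = dB′`, charted set `S = univ`). [cite: Balaban1987RG1, p.268 L.1–5] -/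
theorem hpush_linear (hQH : ∀ y, Q (H y) = y) (hH : ∀ y s, H y (e (Sum.inl s)) = 0)
    (hC : ∀ B s, C B (e (Sum.inl s)) = B s) :
    (((volume : Measure (κ → X)) ⊗ₘ
        (ProbabilityTheory.Kernel.const (κ → X) (volume : Measure (σ → X)))).withDensity
        (fun _ => ((Real.toNNReal |LinearMap.det ((LinearMap.funLeft ℝ X (fun c => e (Sum.inr c))) ∘ₗ H)| : ℝ≥0) : ℝ≥0∞))).map
      (fun p : (κ → X) × (σ → X) => C p.2 + H p.1) = (volume : Measure (ι → X)).restrict Set.univ := by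
  rw [Measure.compProd_const, withDensity_const, Measure.restrict_univ]
  exact (measurePreserving_chart hQH hH hC).map_eq

omit [FiniteDimensional ℝ X] [BorelSpace X] [(volume : Measure X).IsAddHaarMeasure] [Fintype ι] [Fintype κ] [Fintype σ] in
/-- **★ `hfib` OF THE SOCKET, LITERALLY** (for any measure on the chart domain: the fibre identity is exact). [cite: Balaban1987RG1, p.267 L.16–25] -/
theorem hfib_linear (hQH : ∀ y, Q (H y) = y) (hQC : ∀ B, Q (C B) = 0)
    (m : Measure ((κ → X) × (σ → X))) :
    ∀ᵐ z ∂m, Q ((fun p : (κ → X) × (σ → X) => C p.2 + H p.1) z) = z.1 :=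
  Filter.Eventually.of_forall fun z => linearAvg_chart hQH hQC z.1 z.2

end MeasureIdentity

/-! ## §3  The integral identities: `∫ dB′ F(B′) = |det Q_{b₀}|⁻¹ ∫ dy ∫ dB F(CB + hy)` -/

section Integrals

variable {X : Type*} [NormedAddCommGroup X] [NormedSpace ℝ X] [FiniteDimensional ℝ X] [MeasureSpace X] [BorelSpace X]
  [(volume : Measure X).IsAddHaarMeasure]
variable {ι κ σ : Type*} [Fintype ι] [Fintype κ] [Fintype σ] {e : σ ⊕ κ ≃ ι}
variable {Q : (ι → X) →ₗ[ℝ] (κ → X)} {H : (κ → X) →ₗ[ℝ] (ι → X)} {C : (σ → X) →ₗ[ℝ] (ι → X)}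

/-- **★ TONELLI FORM** — for every measurable `g ≥ 0`: `∫⁻ dB′ g(B′) = |det (H↾corridor)| · ∫⁻ dy ∫⁻ dB g(CB + Hy)` (no integrability needed).
[cite: Balaban1987RG1, p.268 L.1–5; Balaban1985UV3, (18) p.260, p.271] -/
theorem lintegral_eq_lintegral_chart (hQH : ∀ y, Q (H y) = y) (hH : ∀ y s, H y (e (Sum.inl s)) = 0)
    (hC : ∀ B s, C B (e (Sum.inl s)) = B s) {g : (ι → X) → ℝ≥0∞} (hg : Measurable g) :
    ∫⁻ B', g B' = ENNReal.ofReal |LinearMap.det ((LinearMap.funLeft ℝ X (fun c => e (Sum.inr c))) ∘ₗ H)| *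
      ∫⁻ y, ∫⁻ B, g (C B + H y) := by
  have hmp := measurePreserving_chart hQH hH hC
  calc ∫⁻ B', g B' = ∫⁻ B', g B' ∂(Measure.map (fun p : (κ → X) × (σ → X) => C p.2 + H p.1)
        (ENNReal.ofReal |LinearMap.det ((LinearMap.funLeft ℝ X (fun c => e (Sum.inr c))) ∘ₗ H)| • (volume.prod volume))) := by
        rw [hmp.map_eq]
    _ = _ := by
        rw [lintegral_map hg measurable_chart, lintegral_smul_measure, smul_eq_mul,
          lintegral_prod (fun p : (κ → X) × (σ → X) => g (C p.2 + H p.1)) (hg.comp measurable_chart).aemeasurable]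

/-- An integrable function of the fine field, composed with the chart, is `dy ⊗ dB`-integrable. [cite: Balaban1987RG1, p.268 L.1–5 (bookkeeping)] -/
theorem integrable_comp_chart (hQH : ∀ y, Q (H y) = y) (hH : ∀ y s, H y (e (Sum.inl s)) = 0)
    (hC : ∀ B s, C B (e (Sum.inl s)) = B s)
    {E : Type*} [NormedAddCommGroup E] {F : (ι → X) → E} (hF : Integrable F) :
    Integrable (fun p : (κ → X) × (σ → X) => F (C p.2 + H p.1)) (volume.prod volume) := by
  have hmp := measurePreserving_chart hQH hH hC
  have h1 : Integrable F (Measure.map (fun p : (κ → X) × (σ → X) => C p.2 + H p.1)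
      (ENNReal.ofReal |LinearMap.det ((LinearMap.funLeft ℝ X (fun c => e (Sum.inr c))) ∘ₗ H)| • (volume.prod volume))) := by
    rw [hmp.map_eq]; exact hF
  have h2 := (integrable_map_measure h1.aestronglyMeasurable measurable_chart.aemeasurable).mp h1
  refine (integrable_smul_measure ?_ ENNReal.ofReal_ne_top).mp h2
  exact (ENNReal.ofReal_pos.mpr (abs_pos.mpr (det_corridorRead_ne_zero hQH hH))).ne'

/-- **★★ THE δ-REMOVAL IDENTITY FOR INTEGRABLE DENSITIES** (the lit-balaban desk's `DeltaRemovalPrinted` SHAPE as a theorem): for every integrable `F`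
of the fine field, `∫ dB′ F(B′) = |det (H↾corridor)| · ∫ dy ∫ dB F(CB + Hy)`, `|det (H↾corridor)| = |det Q_{b₀}|⁻¹` — the printed «∫dB′ δ(Q̃B′ − y) F(B′)»
disintegrated along the block averages. [cite: Balaban1987RG1, (1.4) p.260, p.268 L.1–5; Balaban1985BackgroundPropagators, Sect. E p.428, (3.157); Balaban1985UV3, p.271] -/
theorem integral_eq_integral_chart (hQH : ∀ y, Q (H y) = y) (hH : ∀ y s, H y (e (Sum.inl s)) = 0)
    (hC : ∀ B s, C B (e (Sum.inl s)) = B s)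
    {E : Type*} [NormedAddCommGroup E] [NormedSpace ℝ E] {F : (ι → X) → E} (hF : Integrable F) :
    ∫ B', F B' = |LinearMap.det ((LinearMap.funLeft ℝ X (fun c => e (Sum.inr c))) ∘ₗ H)| •
      ∫ y, ∫ B, F (C B + H y) := by
  have hmp := measurePreserving_chart hQH hH hC
  have hI := integrable_comp_chart hQH hH hC hF
  calc ∫ B', F B' = ∫ B', F B' ∂(Measure.map (fun p : (κ → X) × (σ → X) => C p.2 + H p.1)
        (ENNReal.ofReal |LinearMap.det ((LinearMap.funLeft ℝ X (fun c => e (Sum.inr c))) ∘ₗ H)| • (volume.prod volume))) := by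
        rw [hmp.map_eq]
    _ = ∫ p, F (C p.2 + H p.1) ∂(ENNReal.ofReal |LinearMap.det ((LinearMap.funLeft ℝ X (fun c => e (Sum.inr c))) ∘ₗ H)| •
          ((volume : Measure (κ → X)).prod (volume : Measure (σ → X)))) := by
        refine integral_map measurable_chart.aemeasurable ?_
        rw [hmp.map_eq]
        exact hF.aestronglyMeasurable
    _ = _ := by
        rw [integral_smul_measure, ENNReal.toReal_ofReal (abs_nonneg _), integral_prod _ hI]

/-- The same with the other Fubini order: `∫ dB′ F(B′) = |det (H↾corridor)| · ∫ dB ∫ dy F(CB + Hy)`. [cite: Balaban1987RG1, p.268 L.1–5] -/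
theorem integral_eq_integral_chart_symm (hQH : ∀ y, Q (H y) = y) (hH : ∀ y s, H y (e (Sum.inl s)) = 0)
    (hC : ∀ B s, C B (e (Sum.inl s)) = B s)
    {E : Type*} [NormedAddCommGroup E] [NormedSpace ℝ E] {F : (ι → X) → E} (hF : Integrable F) :
    ∫ B', F B' = |LinearMap.det ((LinearMap.funLeft ℝ X (fun c => e (Sum.inr c))) ∘ₗ H)| •
      ∫ B, ∫ y, F (C B + H y) := by
  rw [integral_eq_integral_chart hQH hH hC hF, ← integral_prod _ (integrable_comp_chart hQH hH hC hF),
    integral_prod_symm _ (integrable_comp_chart hQH hH hC hF)]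

end Integrals

end Summit.QuantumFields.YangMills.Theorems.BalabanUVNodesN11DeltaRemovalLinearFibreChart
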